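import Summits.HodgeConjecture.HodgeConjecture.Theorems.F0P3XiPacketFamilyOfRecordGlue
import Literature.NumberTheory.Automorphic.IrrClassEigencharacter
import HarnessLib

/-!
# THE ξ-LOCAL FAMILY OF RECORD, EDITION 2 (IV): `tXi₀` — the ξ-side e.v.p. IN EIGENCHARACTER CURRENCY, and the laws `XiUnram` ∕ `EvpConvention` (ξ) at it

Cell `hodgecm-mathlib`, F0∕P3 «U3-mult», crux H413 (`stmt-HodgeConjecture-24833`), rung 4 (F0P3-p01 (g7)).  DEF LANE: ONE definition (`xiEvpOfRecord`) +
theorems; no instance, no notation, no named fact, no `sorry`.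

The T5 line v4 (`F0_T5InnerFormClassification`, commit 9a790d6ced2e) fixes ONE junk convention for every e.v.p. field (pin (vi) for `evp`, law `EvpConvention`
for `evpG` ∕ `evpH` ∕ `tXi`): an e.v.p. is a functional on `G′_v → ℂ` that is `μ_v(K_v)⁻¹ · tr` on `C_c(K_v\G′_v/K_v)` and `0` elsewhere — ★ `IrrClass.eigencharacter`
(F0P4-p02 (g6), `Literature/NumberTheory/Automorphic/IrrClassEigencharacter`), the currency of ★ `F0P3ClassTokenChoice.evpChoice` (the kit's `evp` at 𝔠₀).  This file
puts the ξ-side e.v.p. in the SAME currency: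
* `tXi₀ ξ := xiEvpOfRecord … μv ξ` := `v ↦ (πⁿ of record at v).eigencharacter K_v (μv v)` (§1), `K_v` = ★ `cmLocalIntegralLevel L 3 H v`, the packet of record
  ★ `xiPacketFamilyOfRecord` (ED. 2 (I′), p819611);
* law `EvpConvention`, clause (ξ): `tXi₀ ξ v f = 0` off `C_c(K_v\G′_v/K_v)` — `xiEvpOfRecord_of_not` (§1);
* law `XiUnram` at (`packFin₀`, `ram₀`, `tXi₀`): off `ram₀ ξ = ramOfRecord₂ … ξ hexc`, for Haar `μv v`, `πⁿ` is `K_v`-spherical WITH `tXi₀ ξ v` and admissible —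
  `xiUnram_xiEvpOfRecord` (§2; from ★ `isAdmissible_isSpherical_πn_of_good` (II′) + ★ `IsSpherical.isSphericalWith_eigencharacter`), and with the (L-i′) letter
  `XiPinSphericalCofinite` supplying `hexc₀` — `xiUnram_xiEvpOfRecord_of_xiPinSphericalCofinite` (§2);
* normalisation `tXi₀ ξ v (𝟙_{K_v}) = 1` off `ram₀ ξ` (§2, ★ `eigencharacter_indicator_eq_one`) and Langlands' bound `‖tXi₀ ξ v f‖ ≤ μ(K_v)⁻¹ ∫ ‖f‖` for a
  unitarizable member (§2, ★ `norm_eigencharacter_le_inv_mul_integral_norm`).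

References: [Rogawski1990] §12.2 (2) pp. 173–174 («`πⁿ(ξ_v)` is unramified iff `ξ_v` is»), §13.1 p. 199, §13.7 p. 206; [CartierCorvallis1979] §IV.1 Cor. 4.1;
[Langlands1980] p. 209.
HC_CM is proved only modulo the printed citations until rung 0 closes.
-/

set_option autoImplicit false
set_option linter.dupNamespace false

noncomputable section

open NumberField IsDedekindDomain MeasureTheory Filter Topology
open scoped Matrix MatrixGroups

namespace Summit.HodgeConjecture.HodgeConjecture.Cruxes.H413.F0P3XiPacketFamilyOfRecord

open Literature.NumberTheory Literature.NumberTheory.Automorphic Literature.NumberTheory.Automorphic.UnitaryGroup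
open Literature.NumberTheory.Rogawski1990 Literature.NumberTheory.GaloisRepresentations

section Evp

variable (L : Type) [Field L] [NumberField L] [IsCMField L] (H : Matrix (Fin 3) (Fin 3) L)
  (hH : (H.map (cmConjRingHom L))ᵀ = H) (hHd : IsUnit H.det) (μω : HeckeCharacter L) (hμu : μω.IsUnitary)
  -- the local data SHARED with T1's `ComparisonKit` ∕ F0P3b's `CMCharIdentityClauses` ((χ1), RULING (V28)); instance families as there (`borel` at 𝔠₀)
  [∀ v : HeightOneSpectrum (𝓞 ↥(maximalRealSubfield L)), MeasurableSpace ((cmDatum L 3 H).Local v)]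
  [∀ v : HeightOneSpectrum (𝓞 ↥(maximalRealSubfield L)),
    MeasurableSpace ((cmDatum L 2 (Matrix.of fun i j : Fin 2 => if i.val + j.val + 1 = 2 then (1 : L) else 0)).Local v ×
      (cmDatum L 1 (Matrix.of fun i j : Fin 1 => if i.val + j.val + 1 = 1 then (1 : L) else 0)).Local v)]
  [∀ (v : HeightOneSpectrum (𝓞 ↥(maximalRealSubfield L)))
      (a : ((cmDatum L 2 (Matrix.of fun i j : Fin 2 => if i.val + j.val + 1 = 2 then (1 : L) else 0)).Local v ×
        (cmDatum L 1 (Matrix.of fun i j : Fin 1 => if i.val + j.val + 1 = 1 then (1 : L) else 0)).Local v)),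
    MeasurableSpace (((cmDatum L 2 (Matrix.of fun i j : Fin 2 => if i.val + j.val + 1 = 2 then (1 : L) else 0)).Local v ×
        (cmDatum L 1 (Matrix.of fun i j : Fin 1 => if i.val + j.val + 1 = 1 then (1 : L) else 0)).Local v) ⧸
      Subgroup.centralizer ({a} : Set ((cmDatum L 2 (Matrix.of fun i j : Fin 2 => if i.val + j.val + 1 = 2 then (1 : L) else 0)).Local v ×
        (cmDatum L 1 (Matrix.of fun i j : Fin 1 => if i.val + j.val + 1 = 1 then (1 : L) else 0)).Local v)))]
  [∀ (v : HeightOneSpectrum (𝓞 ↥(maximalRealSubfield L))) (γ : (cmDatum L 3 H).Local v),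
    MeasurableSpace ((cmDatum L 3 H).Local v ⧸ Subgroup.centralizer ({γ} : Set ((cmDatum L 3 H).Local v)))]
  [∀ v : HeightOneSpectrum (𝓞 ↥(maximalRealSubfield L)), MeasurableSpace (Gqs L v ⧸ Subgroup.center (Gqs L v))]
  (Δ : ∀ v : HeightOneSpectrum (𝓞 ↥(maximalRealSubfield L)), LocalTransferFactor L H v)
  (mH : ∀ v : HeightOneSpectrum (𝓞 ↥(maximalRealSubfield L)),
    OrbitalMeasureFamily ((cmDatum L 2 (Matrix.of fun i j : Fin 2 => if i.val + j.val + 1 = 2 then (1 : L) else 0)).Local v ×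
      (cmDatum L 1 (Matrix.of fun i j : Fin 1 => if i.val + j.val + 1 = 1 then (1 : L) else 0)).Local v))
  (mG : ∀ v : HeightOneSpectrum (𝓞 ↥(maximalRealSubfield L)), OrbitalMeasureFamily ((cmDatum L 3 H).Local v))
  (νG : ∀ v : HeightOneSpectrum (𝓞 ↥(maximalRealSubfield L)), Measure ((cmDatum L 3 H).Local v))
  (νH : ∀ v : HeightOneSpectrum (𝓞 ↥(maximalRealSubfield L)),
    Measure ((cmDatum L 2 (Matrix.of fun i j : Fin 2 => if i.val + j.val + 1 = 2 then (1 : L) else 0)).Local v ×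
      (cmDatum L 1 (Matrix.of fun i j : Fin 1 => if i.val + j.val + 1 = 1 then (1 : L) else 0)).Local v))
  (ξloc : OneDimAutRepH L → ∀ v : HeightOneSpectrum (𝓞 ↥(maximalRealSubfield L)),
    (cmDatum L 2 (Matrix.of fun i j : Fin 2 => if i.val + j.val + 1 = 2 then (1 : L) else 0)).Local v ×
      (cmDatum L 1 (Matrix.of fun i j : Fin 1 => if i.val + j.val + 1 = 1 then (1 : L) else 0)).Local v →* ℂˣ)
  (μZ : ∀ v : HeightOneSpectrum (𝓞 ↥(maximalRealSubfield L)), Measure (Gqs L v ⧸ Subgroup.center (Gqs L v)))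
  (keys : ∀ (ξ : OneDimAutRepH L) (v : HeightOneSpectrum (𝓞 ↥(maximalRealSubfield L))),
    (∀ w : PlacesOver L v, IsCMField.complexConj L • w.1 = w.1) →
      {p : IrrClass (Gqs L v) × IrrClass (Gqs L v) //
        KeysCaseTwoLabels L v (μω.semilocalComponent L v) (torusLocalComponent L (IsCMField.complexConj L) v ξ.η)
          (torusLocalComponent L (IsCMField.complexConj L) v ξ.ψ) p.1 p.2 ∧
        p.1.IsSquareIntegrable (μZ v) ∧ ¬ p.2.IsSquareIntegrable (μZ v)})
  (hCM : ∀ (ξ : OneDimAutRepH L) (v : HeightOneSpectrum (𝓞 ↥(maximalRealSubfield L)))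
    (hns : ∀ w : PlacesOver L v, IsCMField.complexConj L • w.1 = w.1)
    (T : GL (Fin 3) (LocalRing L v)) (a : LocalRing L v) (ha : IsUnit a)
    (h : formCongr (conjLocal L (IsCMField.complexConj L) v) T (H.map (algebraMap L (LocalRing L v))) =
      a • (Matrix.of fun i j : Fin 3 => if i.val + j.val + 1 = 3 then (1 : L) else 0).map (algebraMap L (LocalRing L v)))
    (π2 πn : IrrClass (Gqs L v)),
    KeysCaseTwoLabels L v (μω.semilocalComponent L v) (torusLocalComponent L (IsCMField.complexConj L) v ξ.η)
      (torusLocalComponent L (IsCMField.complexConj L) v ξ.ψ) π2 πn → ¬ πn.IsSquareIntegrable (μZ v) →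
    CMNonsplitCharIdentityAt L v H (Δ v) (mH v) (mG v) (νG v) (νH v) (ξloc ξ v) (IrrClass.comap (cmDatumLocalCongr L v T ha h).symm πn))
  (hquad : ∀ v : HeightOneSpectrum (𝓞 ↥(maximalRealSubfield L)), (∀ w : PlacesOver L v, IsCMField.complexConj L • w.1 = w.1) →
    IsQuadraticCharExtension (conjLocal L (IsCMField.complexConj L) v) (μω.semilocalComponent L v))


/-! ## §1 `tXi₀`: the ξ-side e.v.p. of record, eigencharacter currency -/

/-- **`tXi₀ ξ` — THE ξ-SIDE e.v.p. OF RECORD** (T5 kit field `tXi` at 𝔠₀): at the finite place `v`, the NORMALISED EIGENCHARACTER at level `K_v = U(H)(𝒪_v)` for the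
measure `μv v` of the unramified-type member `πⁿ` of the packet of record (★ `xiPacketFamilyOfRecord`, ED. 2 (I′)) — `f ↦ μ_v(K_v)⁻¹ · tr πⁿ(f)` on `C_c(K_v\G′_v/K_v)`,
`0` elsewhere (★ `IrrClass.eigencharacter`, the junk convention of law `EvpConvention`).  Off `ram₀ ξ` this IS the e.v.p. `t(ξ_v)` of `πⁿ(ξ_v)` [Rogawski1990 §12.2
p. 174 l. 1; §13.7 p. 206]. [cite: Rogawski1990, §12.2 pp. 173–174; §13.7 p. 206] [cite: CartierCorvallis1979, §IV.1 Cor. 4.1] -/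
def xiEvpOfRecord (μv : ∀ v : HeightOneSpectrum (𝓞 ↥(maximalRealSubfield L)), Measure ((cmDatum L 3 H).Local v)) (ξ : OneDimAutRepH L) :
    ∀ v : HeightOneSpectrum (𝓞 ↥(maximalRealSubfield L)), (((cmDatum L 3 H).Local v) → ℂ) → ℂ :=
  fun v => (xiPacketFamilyOfRecord L H hH hHd μω hμu Δ mH mG νG νH ξloc μZ keys hCM ξ v).πn.eigencharacter (cmLocalIntegralLevel L 3 H v) (μv v)

/-- Unfolding `xiEvpOfRecord`. [cite: CartierCorvallis1979, §IV.1] -/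
theorem xiEvpOfRecord_apply (μv : ∀ v : HeightOneSpectrum (𝓞 ↥(maximalRealSubfield L)), Measure ((cmDatum L 3 H).Local v)) (ξ : OneDimAutRepH L)
    (v : HeightOneSpectrum (𝓞 ↥(maximalRealSubfield L))) :
    xiEvpOfRecord L H hH hHd μω hμu Δ mH mG νG νH ξloc μZ keys hCM μv ξ v = (xiPacketFamilyOfRecord L H hH hHd μω hμu Δ mH mG νG νH ξloc μZ keys hCM ξ v).πn.eigencharacter (cmLocalIntegralLevel L 3 H v) (μv v) :=
  rfl

/-- **LAW `EvpConvention`, CLAUSE (ξ), AT 𝔠₀**: off `C_c(K_v\G′_v/K_v)` the ξ-side e.v.p. of record is `0` (★ `IrrClass.eigencharacter_of_not`).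
[cite: CartierCorvallis1979, §IV.1] [cite: Rogawski1990, §13.7 p. 206] -/
theorem xiEvpOfRecord_of_not (μv : ∀ v : HeightOneSpectrum (𝓞 ↥(maximalRealSubfield L)), Measure ((cmDatum L 3 H).Local v)) (ξ : OneDimAutRepH L)
    (v : HeightOneSpectrum (𝓞 ↥(maximalRealSubfield L))) (f : (cmDatum L 3 H).Local v → ℂ)
    (hf : ¬ (HasCompactSupport f ∧ IsLevel (cmLocalIntegralLevel L 3 H v) f)) : xiEvpOfRecord L H hH hHd μω hμu Δ mH mG νG νH ξloc μZ keys hCM μv ξ v f = 0 :=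
  IrrClass.eigencharacter_of_not _ _ _ hf

/-- The `EvpConvention` (ξ) clause as the T5 line quantifies it (all `ξ v f` at once). [cite: CartierCorvallis1979, §IV.1] -/
theorem evpConvention_xi_xiEvpOfRecord (μv : ∀ v : HeightOneSpectrum (𝓞 ↥(maximalRealSubfield L)), Measure ((cmDatum L 3 H).Local v)) :
    ∀ (ξ : OneDimAutRepH L) (v : HeightOneSpectrum (𝓞 ↥(maximalRealSubfield L))) (f : (cmDatum L 3 H).Local v → ℂ),
      ¬ (HasCompactSupport f ∧ IsLevel (cmLocalIntegralLevel L 3 H v) f) → xiEvpOfRecord L H hH hHd μω hμu Δ mH mG νG νH ξloc μZ keys hCM μv ξ v f = 0 :=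
  fun ξ v f hf => xiEvpOfRecord_of_not L H hH hHd μω hμu Δ mH mG νG νH ξloc μZ keys hCM μv ξ v f hf

/-! ## §2 Law `XiUnram` at `tXi₀` -/

/-- **LAW `XiUnram` AT 𝔠₀ IN EIGENCHARACTER CURRENCY, «good place» form**: at a place `v` good for the record (all of `η̃, ψ̃, μ` unramified over `v`, `H`
`𝒪_v`-unimodular, and — if `v` is non-split — a level-matching congruence exists and the Keys member is `K_v`-spherical), for a Haar measure `μv v` on `G′_v`, the
member `πⁿ` of record is `K_v`-spherical WITH `tXi₀ ξ v` and admissible (★ `isAdmissible_isSpherical_πn_of_good` + ★ `IsSpherical.isSphericalWith_eigencharacter`,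
`K_v` compact open ★ `isCompact_isOpen_cmLocalIntegralLevel`, `μ_v(K_v) ≠ 0` ★ `measureReal_cmLocalIntegralLevel_ne_zero`).
[cite: Rogawski1990, §12.2 pp. 173–174; §13.1 p. 199; §13.7 p. 206] [cite: CartierCorvallis1979, §IV.1 Cor. 4.1] -/
theorem xiUnram_xiEvpOfRecord_of_good (μv : ∀ v : HeightOneSpectrum (𝓞 ↥(maximalRealSubfield L)), Measure ((cmDatum L 3 H).Local v))
    (ξ : OneDimAutRepH L) (v : HeightOneSpectrum (𝓞 ↥(maximalRealSubfield L))) [BorelSpace ((cmDatum L 3 H).Local v)] [(μv v).IsHaarMeasure]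
    (hgood : (∀ w : PlacesOver L v, ξ.bcη.IsUnramifiedAt w.1 ∧ ξ.bcψ.IsUnramifiedAt w.1 ∧ μω.IsUnramifiedAt w.1 ∧
          (isUnit_placeForm_of_isUnit_det hHd w.1).unit ∈ glInt 3 (w.1.adicCompletion L)) ∧
        (∀ hns : ∀ w : PlacesOver L v, IsCMField.complexConj L • w.1 = w.1,
          (∃ (T' : GL (Fin 3) (LocalRing L v)) (a' : LocalRing L v) (ha' : IsUnit a')
          (h' : formCongr (conjLocal L (IsCMField.complexConj L) v) T' (H.map (algebraMap L (LocalRing L v))) =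
            a' • (Matrix.of fun i j : Fin 3 => if i.val + j.val + 1 = 3 then (1 : L) else 0).map (algebraMap L (LocalRing L v))),
          ∀ g : (cmDatum L 3 H).Local v, (cmDatumLocalCongr L v T' ha' h').symm g ∈ cmLocalIntegralLevel L 3 (qsForm L) v ↔
            g ∈ cmLocalIntegralLevel L 3 H v) ∧
          ((keys ξ v hns).1.2).IsSpherical (cmLocalIntegralLevel L 3 (qsForm L) v))) :
    (xiPacketFamilyOfRecord L H hH hHd μω hμu Δ mH mG νG νH ξloc μZ keys hCM ξ v).πn.IsSphericalWith (cmLocalIntegralLevel L 3 H v) (μv v) (xiEvpOfRecord L H hH hHd μω hμu Δ mH mG νG νH ξloc μZ keys hCM μv ξ v) ∧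
      (xiPacketFamilyOfRecord L H hH hHd μω hμu Δ mH mG νG νH ξloc μZ keys hCM ξ v).πn.IsAdmissible := by
  obtain ⟨hadm, hsph⟩ := isAdmissible_isSpherical_πn_of_good L H hH hHd μω hμu Δ mH mG νG νH ξloc μZ keys hCM ξ v hgood
  exact ⟨IrrClass.IsSpherical.isSphericalWith_eigencharacter (μv v) hadm (isCompact_isOpen_cmLocalIntegralLevel L 3 H v).2
    (isCompact_isOpen_cmLocalIntegralLevel L 3 H v).1 (F0P3XiUnramSplitInstance.measureReal_cmLocalIntegralLevel_ne_zero L H v (μv v)) hsph, hadm⟩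

/-- **LAW `XiUnram` AT 𝔠₀ IN EIGENCHARACTER CURRENCY**: with `ram₀ ξ := ramOfRecord₂ … ξ hexc`, for `v ∉ ram₀ ξ` and a Haar measure `μv v` on `G′_v`, the member `πⁿ`
of record is `K_v`-spherical WITH `tXi₀ ξ v` and admissible — literally the `XiUnram` conjunct of the T5 line at (`packFin₀`, `ram₀`, `μv`, `tXi₀`).
[cite: Rogawski1990, §12.2 pp. 173–174; §13.1 p. 199; §13.7 p. 206] [cite: CartierCorvallis1979, §IV.1 Cor. 4.1] -/
theorem xiUnram_xiEvpOfRecord (μv : ∀ v : HeightOneSpectrum (𝓞 ↥(maximalRealSubfield L)), Measure ((cmDatum L 3 H).Local v)) (ξ : OneDimAutRepH L)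
    {hexc : ∀ᶠ v : HeightOneSpectrum (𝓞 ↥(maximalRealSubfield L)) in cofinite,
      ∀ hns : ∀ w : PlacesOver L v, IsCMField.complexConj L • w.1 = w.1,
        ((keys ξ v hns).1.2).IsSpherical (cmLocalIntegralLevel L 3 (qsForm L) v)}
    (v : HeightOneSpectrum (𝓞 ↥(maximalRealSubfield L))) (hv : v ∉ ramOfRecord₂ L H hH hHd μω μZ keys ξ hexc)
    [BorelSpace ((cmDatum L 3 H).Local v)] [(μv v).IsHaarMeasure] :
    (xiPacketFamilyOfRecord L H hH hHd μω hμu Δ mH mG νG νH ξloc μZ keys hCM ξ v).πn.IsSphericalWith (cmLocalIntegralLevel L 3 H v) (μv v) (xiEvpOfRecord L H hH hHd μω hμu Δ mH mG νG νH ξloc μZ keys hCM μv ξ v) ∧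
      (xiPacketFamilyOfRecord L H hH hHd μω hμu Δ mH mG νG νH ξloc μZ keys hCM ξ v).πn.IsAdmissible :=
  xiUnram_xiEvpOfRecord_of_good L H hH hHd μω hμu Δ mH mG νG νH ξloc μZ keys hCM μv ξ v (good_of_not_mem_ramOfRecord₂ L H hH hHd μω μZ keys ξ hv)

/-- **LAW `XiUnram` AT 𝔠₀ FROM THE LETTERS OF RECORD, eigencharacter currency**: with `hexc₀ ξ := hexc_of_xiPinSphericalCofinite … hLi … ξ` ((L-i′) ★
`XiPinSphericalCofinite`) and `ram₀ ξ := ramOfRecord₂ … ξ (hexc₀ ξ)`, for `v ∉ ram₀ ξ` and Haar `μv v`: `πⁿ` of record is `K_v`-spherical WITH `tXi₀ ξ v` and admissible.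
[cite: Rogawski1990, §12.2 pp. 173–174; §13.1 p. 199; §13.7 pp. 206–208] [cite: CartierCorvallis1979, §IV.1 Cor. 4.1] -/
theorem xiUnram_xiEvpOfRecord_of_xiPinSphericalCofinite
    [∀ v : HeightOneSpectrum (𝓞 ↥(maximalRealSubfield L)), BorelSpace (Gqs L v ⧸ Subgroup.center (Gqs L v))]
    [∀ v : HeightOneSpectrum (𝓞 ↥(maximalRealSubfield L)), (μZ v).IsHaarMeasure] (hLi : XiPinSphericalCofinite L) (μv : ∀ v : HeightOneSpectrum (𝓞 ↥(maximalRealSubfield L)), Measure ((cmDatum L 3 H).Local v))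
    (ξ : OneDimAutRepH L) (v : HeightOneSpectrum (𝓞 ↥(maximalRealSubfield L)))
    (hv : v ∉ ramOfRecord₂ L H hH hHd μω μZ keys ξ (hexc_of_xiPinSphericalCofinite L μω hμu μZ keys hquad hLi ξ))
    [BorelSpace ((cmDatum L 3 H).Local v)] [(μv v).IsHaarMeasure] :
    (xiPacketFamilyOfRecord L H hH hHd μω hμu Δ mH mG νG νH ξloc μZ keys hCM ξ v).πn.IsSphericalWith (cmLocalIntegralLevel L 3 H v) (μv v) (xiEvpOfRecord L H hH hHd μω hμu Δ mH mG νG νH ξloc μZ keys hCM μv ξ v) ∧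
      (xiPacketFamilyOfRecord L H hH hHd μω hμu Δ mH mG νG νH ξloc μZ keys hCM ξ v).πn.IsAdmissible :=
  xiUnram_xiEvpOfRecord L H hH hHd μω hμu Δ mH mG νG νH ξloc μZ keys hCM μv ξ v hv

/-- **NORMALISATION `tXi₀ ξ v (𝟙_{K_v}) = 1`** off `ram₀ ξ` for Haar `μv v` (★ `eigencharacter_indicator_eq_one`). [cite: CartierCorvallis1979, §IV.1 Cor. 4.1] -/
theorem xiEvpOfRecord_indicator_eq_one (μv : ∀ v : HeightOneSpectrum (𝓞 ↥(maximalRealSubfield L)), Measure ((cmDatum L 3 H).Local v))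
    (ξ : OneDimAutRepH L)
    {hexc : ∀ᶠ v : HeightOneSpectrum (𝓞 ↥(maximalRealSubfield L)) in cofinite,
      ∀ hns : ∀ w : PlacesOver L v, IsCMField.complexConj L • w.1 = w.1,
        ((keys ξ v hns).1.2).IsSpherical (cmLocalIntegralLevel L 3 (qsForm L) v)}
    (v : HeightOneSpectrum (𝓞 ↥(maximalRealSubfield L))) (hv : v ∉ ramOfRecord₂ L H hH hHd μω μZ keys ξ hexc)
    [BorelSpace ((cmDatum L 3 H).Local v)] [(μv v).IsHaarMeasure] :
    xiEvpOfRecord L H hH hHd μω hμu Δ mH mG νG νH ξloc μZ keys hCM μv ξ v ((cmLocalIntegralLevel L 3 H v : Set ((cmDatum L 3 H).Local v)).indicator fun _ => (1 : ℂ)) = 1 := by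
  obtain ⟨hadm, hsph⟩ := isAdmissible_isSpherical_πn_of_good L H hH hHd μω hμu Δ mH mG νG νH ξloc μZ keys hCM ξ v (good_of_not_mem_ramOfRecord₂ L H hH hHd μω μZ keys ξ hv)
  exact IrrClass.eigencharacter_indicator_eq_one (μv v) hadm (isCompact_isOpen_cmLocalIntegralLevel L 3 H v).2
    (isCompact_isOpen_cmLocalIntegralLevel L 3 H v).1 (F0P3XiUnramSplitInstance.measureReal_cmLocalIntegralLevel_ne_zero L H v (μv v)) hsph

/-- **UNRAMIFIED-MEMBER GLUE at a single place** (the mechanism of T5's `unramMember_of_pins`, stated for the record): off `ram₀ ξ`, for Haar `μv v`, ANY admissible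
class `c` that is `K_v`-spherical WITH the e.v.p. `tXi₀ ξ v` IS the member `πⁿ` of record (★ `IrrClass.eq_of_isSphericalWith`).
[cite: CartierCorvallis1979, §IV.1 Thm. 4.1, Cor. 4.1] [cite: Rogawski1990, §12.2 p. 174] -/
theorem eq_πn_of_isSphericalWith_xiEvpOfRecord (μv : ∀ v : HeightOneSpectrum (𝓞 ↥(maximalRealSubfield L)), Measure ((cmDatum L 3 H).Local v))
    (ξ : OneDimAutRepH L)
    {hexc : ∀ᶠ v : HeightOneSpectrum (𝓞 ↥(maximalRealSubfield L)) in cofinite,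
      ∀ hns : ∀ w : PlacesOver L v, IsCMField.complexConj L • w.1 = w.1,
        ((keys ξ v hns).1.2).IsSpherical (cmLocalIntegralLevel L 3 (qsForm L) v)}
    (v : HeightOneSpectrum (𝓞 ↥(maximalRealSubfield L))) (hv : v ∉ ramOfRecord₂ L H hH hHd μω μZ keys ξ hexc)
    [BorelSpace ((cmDatum L 3 H).Local v)] [(μv v).IsHaarMeasure] {c : IrrClass ((cmDatum L 3 H).Local v)} (hadm : c.IsAdmissible)
    (hc : c.IsSphericalWith (cmLocalIntegralLevel L 3 H v) (μv v) (xiEvpOfRecord L H hH hHd μω hμu Δ mH mG νG νH ξloc μZ keys hCM μv ξ v)) :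
    c = (xiPacketFamilyOfRecord L H hH hHd μω hμu Δ mH mG νG νH ξloc μZ keys hCM ξ v).πn := by
  obtain ⟨hsw, hadm'⟩ := xiUnram_xiEvpOfRecord L H hH hHd μω hμu Δ mH mG νG νH ξloc μZ keys hCM μv ξ v hv
  exact IrrClass.eq_of_isSphericalWith (μv v) hadm hadm' (isCompact_isOpen_cmLocalIntegralLevel L 3 H v).2
    (isCompact_isOpen_cmLocalIntegralLevel L 3 H v).1 (F0P3XiUnramSplitInstance.measureReal_cmLocalIntegralLevel_ne_zero L H v (μv v)) hc hsw

end Evp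

end Summit.HodgeConjecture.HodgeConjecture.Cruxes.H413.F0P3XiPacketFamilyOfRecord

end
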